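import Mathlib
import Summits.NavierStokesRegularity.NavierStokesRegularity.Theorems.WakeRatchetTailRatchetDyadicTypeIRate
import HarnessLib

/-!
# `WakeRatchet.TailRatchet` (stmt-NavierStokesRegularity-21808), door D4′ — the ENERGY CLOCK of the
# non-negative dyadic chain: tail energy `E` above shell `N` forces loss of regularity within
# `4Λ^{3/2}(Λ−1)^{-3/2}·Λ^{-N}E^{-1/2}` (quantitative Katz–Pavlović, scale-invariant form)

Companion of `WakeRatchetTailRatchetDyadicTypeI` / `…TypeIRate`.  MODEL lattice ODEs only (the scalar
dyadic chain `Ẋₙ = Λⁿ⁻¹Xₙ₋₁² − ΛⁿXₙXₙ₊₁`, Tao 2016 §1.2 / §4 with `m = 1`, any `Λ > 1`); nothing here is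
a statement about the Navier–Stokes equations; stmt-21808 is neither proved nor refuted here; no stub of
skeleton d00b85951d7c is closed.

The Riccati functional `P = Λᴺ Σ_{n≥N} Xₙ` of the companion files obeys, besides `Ṗ ≥ kP²`
(`k = (Λ−1)²/(2Λ²)`), the LINEAR drive `Ṗ ≥ (Λ−1)/(2Λ)·Σⱼ ΛʲZⱼ² ≥ (Λ−1)/(2Λ)·Λ^{2N}·Σ_{n≥N}Xₙ²`
(`drive_lower_bound`): as long as the tail energy above shell `N` stays `≥ E` (for non-negative
solutions it is non-decreasing — one-way flux — so a floor at one instant persists), `P` grows at least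
linearly and then quadratically.  Consequences recorded here (def-free):

* `time_sq_le_of_lin_sq_growth` — comparison lemma: `f' ≥ m > 0`, `f' ≥ k f²`, `f(t₀) ≥ 0` on
  `[t₀, T)` ⇒ `(T − t₀)² ≤ 4/(k m)` (linear phase to `t₀ + (T−t₀)/2`, then `time_le_of_sq_growth`);
* `blowup_time_sq_le_of_energy` — ℕ-indexed (shells above an anchor, any non-negative feed into the
  anchor, regularity = geometric envelopes on compact sub-intervals): an energy floor
  `Σⱼ Zⱼ(t)² ≥ E > 0` on `[t₀, T)` and `Zⱼ(t₀) ≥ 0` give `(T − t₀)²·E ≤ 16Λ³/(Λ−1)³`;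
* `energyClock_dyadic` — the ℤ-indexed dyadic chain: if `X` solves the law at every shell `n ≥ N` on
  `(a,T)`, `Λⁿ|Xₙ|` is bounded on every `(a,T′)`, `T′ < T` (shells `n ≥ N−1`), the shells `n ≥ N` are
  non-negative at `t₀ ∈ (a,T)` and the tail energy above `N` stays `≥ E` on `[t₀,T)`, then
  `(T − t₀)²·Λ^{2N}·E ≤ 16Λ³/(Λ−1)³`.  READ AT THE BLOW-UP TIME `T = T*` of a non-negative solution (tails
  non-decreasing): `T* − t ≤ 4Λ^{3/2}(Λ−1)^{-3/2}·Λ^{-N}·tail_N(t)^{-1/2}` — energy that has reached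
  shell `N` is transported to infinitely high shells within that many turnover times; the firing-time
  input of the D4′ bookkeeping (`WakeRatchetFiringClock`) in energy form.

HONEST FRAMING: elementary real analysis on the lemma layer; the wake-control inputs of door D4′
(per-shell action, post-firing decay) and the extraction are NOT addressed; rung 0.
-/

noncomputable section

set_option linter.dupNamespace false

namespace Summit.NavierStokesRegularity.NavierStokesRegularity.Theorems

namespace WakeRatchetDyadicTypeI

open Set Filter Topology

/-! ## Linear-then-quadratic comparison -/

/-- **Comparison for `f' ≥ m` and `f' ≥ k f²`.**  If `f` is differentiable on `[t₀, T)` with `f' ≥ m > 0`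
and `f' ≥ k f²` (`k > 0`) there and `f(t₀) ≥ 0`, then `(T − t₀)² ≤ 4/(k m)`. [folklore] -/
theorem time_sq_le_of_lin_sq_growth {f f' : ℝ → ℝ} {k m t₀ T : ℝ} (hk : 0 < k) (hm : 0 < m)
    (ht : t₀ < T) (hf : ∀ t ∈ Ico t₀ T, HasDerivAt f (f' t) t)
    (hlin : ∀ t ∈ Ico t₀ T, m ≤ f' t) (hsq : ∀ t ∈ Ico t₀ T, k * f t ^ 2 ≤ f' t)
    (h0 : 0 ≤ f t₀) : (T - t₀) ^ 2 ≤ 4 / (k * m) := by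
  -- the midpoint
  set τ : ℝ := (T - t₀) / 2 with hτdef
  have hτ : 0 < τ := by rw [hτdef]; linarith
  set t₁ : ℝ := t₀ + τ with ht₁def
  have ht₁0 : t₀ ≤ t₁ := by rw [ht₁def]; linarith
  have ht₁T : t₁ < T := by rw [ht₁def, hτdef]; linarith
  -- linear phase: `f(t₁) ≥ m τ`
  have hcont : ContinuousOn f (Ico t₀ T) := fun t ht => (hf t ht).continuousAt.continuousWithinAt
  have hint : interior (Ico t₀ T) = Ioo t₀ T := interior_Ico
  set g : ℝ → ℝ := fun t => f t - m * t with hgdef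
  have hg : ∀ t ∈ Ico t₀ T, HasDerivAt g (f' t - m) t := by
    intro t ht'
    have h2 : HasDerivAt (fun s => m * s) m t := by simpa using (hasDerivAt_id t).const_mul m
    exact (hf t ht').sub h2
  have hgmono : MonotoneOn g (Ico t₀ T) := by
    refine monotoneOn_of_hasDerivWithinAt_nonneg (f' := fun t => f' t - m) (convex_Ico t₀ T)
      (fun t ht' => (hg t ht').continuousAt.continuousWithinAt) ?_ ?_
    · intro t ht'
      rw [hint] at ht'
      exact (hg t (Ioo_subset_Ico_self ht')).hasDerivWithinAt
    · intro t ht'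
      rw [hint] at ht'
      linarith [hlin t (Ioo_subset_Ico_self ht')]
  have hft₁ : m * τ ≤ f t₁ := by
    have h := hgmono (left_mem_Ico.2 ht) ⟨ht₁0, ht₁T⟩ ht₁0
    simp only [hgdef, ht₁def] at h
    linarith
  have hft₁pos : 0 < f t₁ := (mul_pos hm hτ).trans_le hft₁
  -- quadratic phase from `t₁`
  have hcomp := time_le_of_sq_growth hk ht₁T
    (fun t ht' => hf t ⟨ht₁0.trans ht'.1, ht'.2⟩)
    (fun t ht' => hsq t ⟨ht₁0.trans ht'.1, ht'.2⟩) hft₁pos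
  have hTt₁ : T - t₁ = τ := by rw [ht₁def, hτdef]; ring
  rw [hTt₁] at hcomp
  -- `m τ² ≤ τ f(t₁) ≤ 1/k`
  have h1 : m * τ ^ 2 ≤ k⁻¹ := by
    calc m * τ ^ 2 = τ * (m * τ) := by ring
      _ ≤ τ * f t₁ := mul_le_mul_of_nonneg_left hft₁ hτ.le
      _ ≤ k⁻¹ := hcomp
  have h2 : (T - t₀) ^ 2 = 4 * τ ^ 2 := by rw [hτdef]; ring
  rw [h2, le_div_iff₀ (mul_pos hk hm)]
  have h3 : k * (m * τ ^ 2) ≤ k * k⁻¹ := mul_le_mul_of_nonneg_left h1 hk.le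
  rw [mul_inv_cancel₀ hk.ne'] at h3
  nlinarith [h3]

/-! ## The energy clock, ℕ-indexed -/

/-- **Energy clock above an anchor.**  In the setting of `blowup_time_le` (shells `Zⱼ`, `j ≥ 0`, above an
anchor, dyadic law with any non-negative feed into the anchor, regular on every `(a,T′)`, `T′ < T`),
suppose `Zⱼ(t₀) ≥ 0` for all `j` and the energy floor `Σⱼ Zⱼ(t)² ≥ E > 0` holds on `[t₀, T)`.  Then
`(T − t₀)²·E ≤ 16Λ³/(Λ−1)³`.
[cite: Tao2016AveragedNS, §1.2 (dyadic model), §4 Lemma 4.1 (4.8)–(4.10); elementary] -/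
theorem blowup_time_sq_le_of_energy {Λ a T E : ℝ} (hΛ : 1 < Λ) (hE : 0 < E) {Z dZ : ℕ → ℝ → ℝ}
    (hder : ∀ j, ∀ t ∈ Ioo a T, HasDerivAt (Z j) (dZ j t) t)
    (h0 : ∀ t ∈ Ioo a T, -(Z 0 t * Z 1 t) ≤ dZ 0 t)
    (hS : ∀ j, ∀ t ∈ Ioo a T,
      Λ ^ j * Z j t ^ 2 - Λ ^ (j + 1) * Z (j + 1) t * Z (j + 2) t ≤ dZ (j + 1) t)
    (hreg : ∀ T', T' < T → ∃ B : ℝ, ∀ j, ∀ t ∈ Ioo a T', |Z j t| ≤ B * Λ⁻¹ ^ j ∧ |dZ j t| ≤ B * Λ⁻¹ ^ j)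
    {t₀ : ℝ} (ht₀ : t₀ ∈ Ioo a T) (hpos : ∀ j, 0 ≤ Z j t₀)
    (hfloor : ∀ t ∈ Ico t₀ T, E ≤ ∑' j, Z j t ^ 2) :
    (T - t₀) ^ 2 * E ≤ 16 * Λ ^ 3 / (Λ - 1) ^ 3 := by
  have hΛ0 : 0 < Λ := by linarith
  have hΛ1 : 0 < Λ - 1 := by linarith
  set C : ℝ := 16 * Λ ^ 3 / (Λ - 1) ^ 3 with hCdef
  have hC : 0 < C := by positivity
  have hk : 0 < (Λ - 1) ^ 2 / (2 * Λ ^ 2) := by positivity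
  have hm : 0 < (Λ - 1) / (2 * Λ) * E := by positivity
  have hkm : 4 / ((Λ - 1) ^ 2 / (2 * Λ ^ 2) * ((Λ - 1) / (2 * Λ) * E)) = C / E := by
    rw [hCdef]; field_simp; ring
  -- the bound on every `[t₀, T')`, `T' < T`
  have key : ∀ T', t₀ < T' → T' < T → (T' - t₀) ^ 2 * E ≤ C := by
    intro T' hT'0 hT'T
    obtain ⟨B, hB⟩ := hreg T' hT'T
    have hU : IsOpen (Ioo a T') := isOpen_Ioo
    have hU' : IsPreconnected (Ioo a T') := isPreconnected_Ioo
    have ht₀U : t₀ ∈ Ioo a T' := ⟨ht₀.1, hT'0⟩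
    have hsub : Ioo a T' ⊆ Ioo a T := Ioo_subset_Ioo_right hT'T.le
    set P : ℝ → ℝ := fun t => ∑' j, Z j t with hPdef
    have hPder : ∀ t ∈ Ioo a T', HasDerivAt P (∑' j, dZ j t) t := by
      intro t ht
      exact hasDerivAt_tsum_of_isPreconnected ((summable_inv_pow hΛ).mul_left B) hU hU'
        (fun j y hy => hder j y (hsub hy)) (fun j y hy => by
          rw [Real.norm_eq_abs]; exact (hB j y hy).2) ht₀U
        (summable_of_envelope hΛ fun j => (hB j t₀ ht₀U).1) ht
    -- quadratic drive
    have hgrow : ∀ t ∈ Ico t₀ T', (Λ - 1) ^ 2 / (2 * Λ ^ 2) * P t ^ 2 ≤ ∑' j, dZ j t := by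
      intro t ht
      have htU : t ∈ Ioo a T' := ⟨ht₀.1.trans_le ht.1, ht.2⟩
      have htT : t ∈ Ioo a T := hsub htU
      exact sq_growth_at_instant hΛ (fun j => (hB j t htU).1)
        (summable_of_envelope hΛ fun j => (hB j t htU).2) (h0 t htT) (fun j => hS j t htT)
    -- linear drive from the energy floor
    have hlin : ∀ t ∈ Ico t₀ T', (Λ - 1) / (2 * Λ) * E ≤ ∑' j, dZ j t := by
      intro t ht
      have htU : t ∈ Ioo a T' := ⟨ht₀.1.trans_le ht.1, ht.2⟩
      have htT : t ∈ Ioo a T := hsub htU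
      have hz : ∀ j, |Z j t| ≤ B * Λ⁻¹ ^ j := fun j => (hB j t htU).1
      have hdrive := drive_lower_bound hΛ hz
        (summable_of_envelope hΛ fun j => (hB j t htU).2) (h0 t htT) (fun j => hS j t htT)
      -- `Σ Zⱼ² ≤ Σ Λʲ Zⱼ²`
      have hSq := summable_sq_of_envelope hΛ hz
      have hsq1 : Summable fun j => Z j t ^ 2 := by
        refine Summable.of_nonneg_of_le (fun j => sq_nonneg _) (fun j => ?_) hSq
        have h1 : (1 : ℝ) ≤ Λ ^ j := one_le_pow₀ hΛ.le
        nlinarith [sq_nonneg (Z j t)]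
      have hcmp : ∑' j, Z j t ^ 2 ≤ ∑' j, Λ ^ j * Z j t ^ 2 :=
        hsq1.tsum_le_tsum (fun j => by
          have h1 : (1 : ℝ) ≤ Λ ^ j := one_le_pow₀ hΛ.le
          nlinarith [sq_nonneg (Z j t)]) hSq
      have hfl := hfloor t ⟨ht.1, ht.2.trans hT'T⟩
      have hc1 : 0 ≤ (Λ - 1) / (2 * Λ) := by positivity
      calc (Λ - 1) / (2 * Λ) * E ≤ (Λ - 1) / (2 * Λ) * ∑' j, Λ ^ j * Z j t ^ 2 :=
            mul_le_mul_of_nonneg_left (hfl.trans hcmp) hc1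
        _ ≤ ∑' j, dZ j t := hdrive
    -- `P(t₀) ≥ 0`
    have hP0 : 0 ≤ P t₀ := tsum_nonneg hpos
    have hcomp := time_sq_le_of_lin_sq_growth hk hm hT'0
      (fun t ht => hPder t ⟨ht₀.1.trans_le ht.1, ht.2⟩) hlin hgrow hP0
    rw [hkm, le_div_iff₀ hE] at hcomp
    exact hcomp
  -- pass to `T`
  by_contra hcon
  push Not at hcon
  set L : ℝ := T - t₀ with hLdef
  have hL : 0 < L := by rw [hLdef]; linarith [ht₀.2]
  have hCL : C < L ^ 2 * E := by rw [hLdef]; linarith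
  -- the instant `s = t₀ + (L + C/(L E))/2`
  set s : ℝ := t₀ + (L + C / (L * E)) / 2 with hsdef
  have hLE : 0 < L * E := mul_pos hL hE
  have hq : C / (L * E) < L := by rw [div_lt_iff₀ hLE]; nlinarith
  have hq0 : 0 < C / (L * E) := div_pos hC hLE
  have hs0 : t₀ < s := by rw [hsdef]; linarith
  have hsT : s < T := by
    have : s - t₀ < L := by rw [hsdef]; linarith
    rw [hLdef] at this; linarith
  have h := key s hs0 hsT
  -- `(s − t₀)² E − C = ((L − C/(LE))/2)² E + … > 0`
  have hid : (s - t₀) ^ 2 * E - C = ((L - C / (L * E)) / 2) ^ 2 * E := by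
    rw [hsdef]
    field_simp
    ring
  have hpos' : 0 < ((L - C / (L * E)) / 2) ^ 2 * E := by
    have : 0 < (L - C / (L * E)) / 2 := by linarith
    positivity
  linarith [hid, hpos', h]

/-! ## The ℤ-indexed dyadic chain: the energy clock -/

/-- **ENERGY CLOCK OF THE NON-NEGATIVE DYADIC CHAIN.**  Let `Λ > 1` and let `X : ℤ → ℝ → ℝ` solve
`Ẋₙ = Λⁿ⁻¹ Xₙ₋₁² − Λⁿ Xₙ Xₙ₊₁` on `(a, T)` for every shell `n ≥ N`, regular on every `(a, T′)`, `T′ < T`,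
above shell `N − 1` (`Λⁿ|Xₙ| ≤ B` there).  If at `t₀ ∈ (a, T)` the shells `n ≥ N` are non-negative and
the tail energy above `N` stays `≥ E > 0` on `[t₀, T)` (for non-negative solutions: `tail_N(t₀) ≥ E`,
tails being non-decreasing), then `(T − t₀)²·Λ^{2N}·E ≤ 16Λ³/(Λ−1)³`.  Read at the blow-up time:
`T* − t ≤ 4Λ^{3/2}(Λ−1)^{-3/2}·Λ^{-N}·tail_N(t)^{-1/2}`.
[cite: Tao2016AveragedNS, §1.2 (the dyadic Katz–Pavlović model) and §4 Lemma 4.1 (4.8)–(4.10) with `m = 1`; elementary] -/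
theorem energyClock_dyadic {Λ a T E : ℝ} (hΛ : 1 < Λ) (hE : 0 < E) {X : ℤ → ℝ → ℝ} {N : ℤ}
    (hlaw : ∀ n : ℤ, N ≤ n → ∀ t ∈ Ioo a T,
      HasDerivAt (X n) (Λ ^ (n - 1) * X (n - 1) t ^ 2 - Λ ^ n * X n t * X (n + 1) t) t)
    (hreg : ∀ T', T' < T → ∃ B : ℝ, ∀ n : ℤ, N - 1 ≤ n → ∀ t ∈ Ioo a T', |Λ ^ n * X n t| ≤ B)
    {t₀ : ℝ} (ht₀ : t₀ ∈ Ioo a T) (hpos : ∀ n : ℤ, N ≤ n → 0 ≤ X n t₀)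
    (hfloor : ∀ t ∈ Ico t₀ T, E ≤ ∑' k : ℕ, X (N + k) t ^ 2) :
    (T - t₀) ^ 2 * ((Λ ^ N) ^ 2 * E) ≤ 16 * Λ ^ 3 / (Λ - 1) ^ 3 := by
  have hΛ0 : 0 < Λ := by linarith
  have hΛne : Λ ≠ 0 := hΛ0.ne'
  -- the rescaled shells above the anchor, their derivatives, and the shell below the anchor
  set Z : ℕ → ℝ → ℝ := fun j t => Λ ^ N * X (N + j) t with hZdef
  set dZ : ℕ → ℝ → ℝ := fun j t =>
    Λ ^ N * (Λ ^ (N + j - 1) * X (N + j - 1) t ^ 2 - Λ ^ (N + j) * X (N + j) t * X (N + j + 1) t)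
    with hdZdef
  set V : ℝ → ℝ := fun t => Λ ^ N * X (N - 1) t with hVdef
  -- zpow bookkeeping: `Λᴺ Λ^{N+j} = Λʲ (Λᴺ)²`
  have hzz : ∀ j : ℕ, Λ ^ N * Λ ^ (N + (j : ℤ)) = Λ ^ j * (Λ ^ N * Λ ^ N) := by
    intro j
    rw [zpow_add₀ hΛne, zpow_natCast]; ring
  have hder : ∀ j, ∀ t ∈ Ioo a T, HasDerivAt (Z j) (dZ j t) t := by
    intro j t ht
    have h := (hlaw (N + j) (by omega) t ht).const_mul (Λ ^ N)
    simpa only [hZdef, hdZdef] using h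
  -- the anchor shell: `dZ₀ = Λ⁻¹ V² − Z₀ Z₁`
  have hdZ0 : ∀ t, dZ 0 t = Λ⁻¹ * V t ^ 2 - Z 0 t * Z 1 t := by
    intro t
    simp only [hZdef, hdZdef, hVdef, Nat.cast_zero, add_zero, Nat.cast_one]
    rw [zpow_sub_one₀ hΛne]
    field_simp
  -- the shells above: `dZⱼ₊₁ = Λʲ Zⱼ² − Λʲ⁺¹ Zⱼ₊₁ Zⱼ₊₂`
  have hdZsucc : ∀ j t, dZ (j + 1) t = Λ ^ j * Z j t ^ 2 - Λ ^ (j + 1) * Z (j + 1) t * Z (j + 2) t := by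
    intro j t
    have e1 : N + ((j + 1 : ℕ) : ℤ) - 1 = N + (j : ℤ) := by push_cast; ring
    have e2 : N + ((j + 1 : ℕ) : ℤ) + 1 = N + ((j + 2 : ℕ) : ℤ) := by push_cast; ring
    simp only [hZdef, hdZdef]
    rw [e1, e2, mul_sub]
    congr 1
    · calc Λ ^ N * (Λ ^ (N + (j : ℤ)) * X (N + (j : ℤ)) t ^ 2)
          = (Λ ^ N * Λ ^ (N + (j : ℤ))) * X (N + (j : ℤ)) t ^ 2 := by ring
        _ = Λ ^ j * (Λ ^ N * Λ ^ N) * X (N + (j : ℤ)) t ^ 2 := by rw [hzz j]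
        _ = Λ ^ j * (Λ ^ N * X (N + (j : ℤ)) t) ^ 2 := by ring
    · calc Λ ^ N * (Λ ^ (N + ((j + 1 : ℕ) : ℤ)) * X (N + ((j + 1 : ℕ) : ℤ)) t * X (N + ((j + 2 : ℕ) : ℤ)) t)
          = (Λ ^ N * Λ ^ (N + ((j + 1 : ℕ) : ℤ))) * X (N + ((j + 1 : ℕ) : ℤ)) t
              * X (N + ((j + 2 : ℕ) : ℤ)) t := by ring
        _ = Λ ^ (j + 1) * (Λ ^ N * Λ ^ N) * X (N + ((j + 1 : ℕ) : ℤ)) t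
              * X (N + ((j + 2 : ℕ) : ℤ)) t := by rw [hzz (j + 1)]
        _ = Λ ^ (j + 1) * (Λ ^ N * X (N + ((j + 1 : ℕ) : ℤ)) t)
              * (Λ ^ N * X (N + ((j + 2 : ℕ) : ℤ)) t) := by ring
  have h0 : ∀ t ∈ Ioo a T, -(Z 0 t * Z 1 t) ≤ dZ 0 t := by
    intro t _
    rw [hdZ0 t]
    have : 0 ≤ Λ⁻¹ * V t ^ 2 := by positivity
    linarith
  have hS : ∀ j, ∀ t ∈ Ioo a T,
      Λ ^ j * Z j t ^ 2 - Λ ^ (j + 1) * Z (j + 1) t * Z (j + 2) t ≤ dZ (j + 1) t :=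
    fun j t _ => (hdZsucc j t).symm.le
  -- regularity: geometric envelopes for `Z` and `dZ`
  have hreg' : ∀ T', T' < T → ∃ B : ℝ, ∀ j, ∀ t ∈ Ioo a T',
      |Z j t| ≤ B * Λ⁻¹ ^ j ∧ |dZ j t| ≤ B * Λ⁻¹ ^ j := by
    intro T' hT'
    obtain ⟨B, hB⟩ := hreg T' hT'
    -- `|Zⱼ| = Λ⁻ʲ |Λ^{N+j} X_{N+j}| ≤ |B| Λ⁻ʲ`
    have hZb : ∀ j : ℕ, ∀ t ∈ Ioo a T', |Z j t| ≤ |B| * Λ⁻¹ ^ j := by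
      intro j t ht
      have h := (hB (N + j) (by omega) t ht).trans (le_abs_self B)
      have hid : Z j t = Λ⁻¹ ^ j * (Λ ^ (N + (j : ℤ)) * X (N + (j : ℤ)) t) := by
        simp only [hZdef]
        rw [zpow_add₀ hΛne, zpow_natCast, inv_pow]
        field_simp
      rw [hid, abs_mul, abs_of_nonneg (by positivity)]
      calc Λ⁻¹ ^ j * |Λ ^ (N + (j : ℤ)) * X (N + (j : ℤ)) t| ≤ Λ⁻¹ ^ j * |B| :=
            mul_le_mul_of_nonneg_left h (by positivity)
        _ = |B| * Λ⁻¹ ^ j := mul_comm _ _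
    -- `|V| = Λ |Λ^{N-1} X_{N-1}| ≤ Λ |B|`
    have hVb : ∀ t ∈ Ioo a T', |V t| ≤ Λ * |B| := by
      intro t ht
      have h := (hB (N - 1) le_rfl t ht).trans (le_abs_self B)
      have hid : V t = Λ * (Λ ^ (N - 1) * X (N - 1) t) := by
        simp only [hVdef]
        rw [zpow_sub_one₀ hΛne]
        field_simp
      rw [hid, abs_mul, abs_of_pos hΛ0]
      exact mul_le_mul_of_nonneg_left h hΛ0.le
    refine ⟨Λ * |B| + 2 * Λ * B ^ 2, fun j t ht => ⟨?_, ?_⟩⟩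
    · -- envelope of `Z`
      have h := hZb j t ht
      have hq : 0 ≤ Λ⁻¹ ^ j := by positivity
      have : |B| * Λ⁻¹ ^ j ≤ (Λ * |B| + 2 * Λ * B ^ 2) * Λ⁻¹ ^ j := by
        apply mul_le_mul_of_nonneg_right _ hq
        nlinarith [abs_nonneg B, sq_nonneg B]
      exact h.trans this
    · -- envelope of `dZ`
      rcases j with _ | j
      · rw [hdZ0 t, pow_zero, mul_one]
        have hx : |Z 0 t| ≤ |B| := by simpa using hZb 0 t ht
        have hy : |Z 1 t| ≤ |B| * Λ⁻¹ := by simpa using hZb 1 t ht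
        have := envelope_zero hΛ (hVb t ht) hx hy
        nlinarith [abs_nonneg B, this]
      · rw [hdZsucc j t]
        have := envelope_succ hΛ (hZb j t ht) (hZb (j + 1) t ht) (hZb (j + 2) t ht)
        have hq : 0 ≤ Λ⁻¹ ^ (j + 1) := by positivity
        have h2 : 2 * Λ * B ^ 2 * Λ⁻¹ ^ (j + 1) ≤ (Λ * |B| + 2 * Λ * B ^ 2) * Λ⁻¹ ^ (j + 1) := by
          apply mul_le_mul_of_nonneg_right _ hq
          nlinarith [abs_nonneg B]
        exact this.trans h2
  -- positivity and the energy floor in rescaled units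
  have hposZ : ∀ j : ℕ, 0 ≤ Z j t₀ := by
    intro j
    simp only [hZdef]
    exact mul_nonneg (zpow_pos hΛ0 N).le (hpos _ (by omega))
  have hE' : 0 < (Λ ^ N) ^ 2 * E := mul_pos (pow_pos (zpow_pos hΛ0 N) 2) hE
  have hfloorZ : ∀ t ∈ Ico t₀ T, (Λ ^ N) ^ 2 * E ≤ ∑' j, Z j t ^ 2 := by
    intro t ht
    have h := hfloor t ht
    have hid : ∑' j, Z j t ^ 2 = (Λ ^ N) ^ 2 * ∑' k : ℕ, X (N + k) t ^ 2 := by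
      simp only [hZdef]
      rw [← tsum_mul_left]
      congr 1
      funext k
      ring
    rw [hid]
    exact mul_le_mul_of_nonneg_left h (sq_nonneg _)
  exact blowup_time_sq_le_of_energy hΛ hE' hder h0 hS hreg' ht₀ hposZ hfloorZ

end WakeRatchetDyadicTypeI

end Summit.NavierStokesRegularity.NavierStokesRegularity.Theorems

end
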